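import Summits.ResolutionOfSingularities.ResolutionOfSingularities.Theorems.FrobeniusLadderFInjectiveMacaulayficationNormalSurfaceSop
import Summits.ResolutionOfSingularities.ResolutionOfSingularities.Theorems.FrobeniusLadderFInjectiveMacaulayficationNormalizationModel
import Summits.ResolutionOfSingularities.ResolutionOfSingularities.Theorems.FrobeniusLadderFInjectiveMacaulayficationReductions
import Summits.ResolutionOfSingularities.ResolutionOfSingularities.Theorems.FInjectiveMacaulayfication.Negative.LoadBearing
import Literature.AlgebraicGeometry.Resolution.ArithmeticalThreefolds
import Mathlib.Topology.KrullDimension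

/-!
# Crux `FInjectiveMacaulayfication`: Kawasaki's Macaulayfication in dimension ≤ 2 is a theorem, and the
crux in dimension 2 is the F-injectivization of normal surfaces (line `Sketch`, cycle 6, package B)

Support file for crux `stmt-ResolutionOfSingularities-15315` (`FrobeniusLadder.FInjectiveMacaulayfication`, route
`ResolutionOfSingularities/FrobeniusLadder`, rung 2), line `Sketch`, registered stub `stub_kawasakiIntegralDimLeTwo`
(the lead's assembly of package B).

The skeleton of line `Sketch` composes the rung below — Kawasaki's Macaulayfication, the Literature named fact
`KawasakiMacaulayfication` (Kawasaki 2000, Thm. 1.1; Česnavičius 2021), not discharged in the tree — with the open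
core (F-injectivize an integral Cohen–Macaulay variety). In dimension `≤ 2` the rung below is CLASSICAL and is
proved here: the Macaulayfication of an integral surface is its NORMALIZATION (finite, hence proper; birational;
integral of the same dimension, `NormalizationModel.stub_normalizationModel`), because a normal Noetherian local
domain of dimension `≤ 2` is Cohen–Macaulay (Serre; `NormalSurfaceSop.stub_normalSurfaceSop`).

* `stub_kawasakiIntegralDimLeTwo` — the registered form: `KawasakiMacaulayfication` restricted to `dim X ≤ 2`,
  unconditionally;
* `normalModel_dim_le_two` — the same model remembered to be NORMAL of dimension `≤ 2`;
* `conclusion_dim_le_two_of_fInjectivizeNormalSurfaces` — hence **in dimension `≤ 2` the crux's conclusion for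
  every reduced separated finite-type `X/k` follows from the F-injectivization of NORMAL integral surfaces alone**
  (the open core `stub_fInjectivizeIntegral` restricted to normal input of dimension `≤ 2`): reduce to the
  integral components (`exists_model_of_forall_closeds`, closed subschemes do not raise the dimension), normalize,
  F-injectivize, compose;
* `conclusion_of_dim_le_two` — for comparison, the crux's conclusion in dimension `≤ 2` modulo the named fact
  `CossartJannsenSaito2020` (resolution of surfaces) through `Negative.conclusion_of_hasResolution`; the
  disprover's `Negative.conclusion_of_dim_le_three` gives dimension `≤ 3` modulo `CossartPiltant2019`.

References: H. Matsumura, *Commutative Ring Theory*, Thm. 17.4 and Thm. 23.8 (normal ⇒ `S₂`); Q. Liu,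
*Algebraic Geometry and Arithmetic Curves*, Cor. 4.1.30; T. Kawasaki, Trans. AMS 352 (2000), Thm. 1.1.
[folklore]
-/

-- single-problem summit: the doubled namespace component is forced
set_option linter.dupNamespace false

noncomputable section

namespace Summit.ResolutionOfSingularities.ResolutionOfSingularities.Theorems.FInjectiveMacaulayfication.KawasakiDimLeTwo

open AlgebraicGeometry CategoryTheory TopologicalSpace Literature.AlgebraicGeometry.Resolution

/-- **The normalization of an integral surface is a normal Cohen–Macaulay model**: every integral separated
finite-type `X/k` of dimension `≤ 2` has a proper birational model `X₁ → X` with `X₁` integral of dimension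
`≤ 2`, all of whose local rings are integrally closed Noetherian domains in which every system of parameters is
a weakly regular sequence. [cite: Matsumura1987, Thm. 17.4 and Thm. 23.8] -/
theorem normalModel_dim_le_two (k : Type) [Field k] (X : Scheme.{0}) (f : X ⟶ Spec (.of k))
    [IsSeparated f] [LocallyOfFiniteType f] [QuasiCompact f] [IsIntegral X] (hdim : topologicalKrullDim X ≤ 2) :
    ∃ (X₁ : Scheme.{0}) (π₁ : X₁ ⟶ X), IsProper π₁ ∧ IsBirational π₁ ∧ IsIntegral X₁ ∧
      topologicalKrullDim X₁ ≤ 2 ∧ (∀ x : X₁, IsIntegrallyClosed (X₁.presheaf.stalk x)) ∧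
      ∀ x : X₁, ∀ d : ℕ, ringKrullDim (X₁.presheaf.stalk x) = d →
        ∀ s : Fin d → X₁.presheaf.stalk x, (Ideal.span (Set.range s)).radical.IsMaximal →
          RingTheory.Sequence.IsWeaklyRegular (X₁.presheaf.stalk x) (List.ofFn s) := by
  obtain ⟨X₁, π₁, hprop, hbir, hint₁, hdimeq, hst⟩ :=
    NormalizationModel.stub_normalizationModel k X f inferInstance inferInstance inferInstance inferInstance
  refine ⟨X₁, π₁, hprop, hbir, hint₁, hdimeq.trans_le hdim, fun x => (hst x).1, fun x => ?_⟩
  obtain ⟨hic, hnoeth, hdx⟩ := hst x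
  haveI := hic
  haveI := hnoeth
  haveI := hint₁
  exact NormalSurfaceSop.stub_normalSurfaceSop (X₁.presheaf.stalk x) (hdx.trans hdim)

/-- **KAWASAKI IN DIMENSION ≤ 2 IS A THEOREM** (registered stub `stub_kawasakiIntegralDimLeTwo`): every integral
separated finite-type `X/k` of dimension `≤ 2` has a proper birational INTEGRAL model all of whose local rings
are Cohen–Macaulay (every system of parameters weakly regular) — its normalization. This is the Literature named
fact `KawasakiMacaulayfication` restricted to `dim X ≤ 2`, unconditionally. [cite: Kawasaki2000, Thm 1.1] -/
theorem stub_kawasakiIntegralDimLeTwo : ∀ (k : Type) [Field k] (X : Scheme.{0}) (f : X ⟶ Spec (.of k)),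
    IsSeparated f → LocallyOfFiniteType f → QuasiCompact f → IsIntegral X → topologicalKrullDim X ≤ 2 →
      ∃ (X₁ : Scheme.{0}) (π₁ : X₁ ⟶ X), IsProper π₁ ∧
        Literature.AlgebraicGeometry.Resolution.IsBirational π₁ ∧ IsIntegral X₁ ∧
        ∀ x : X₁, ∀ d : ℕ, ringKrullDim (X₁.presheaf.stalk x) = d →
          ∀ s : Fin d → X₁.presheaf.stalk x, (Ideal.span (Set.range s)).radical.IsMaximal →
            RingTheory.Sequence.IsWeaklyRegular (X₁.presheaf.stalk x) (List.ofFn s) := by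
  intro k _ X f hsep hft hqc hint hdim
  obtain ⟨X₁, π₁, hprop, hbir, hint₁, -, -, hCM⟩ := normalModel_dim_le_two k X f hdim
  exact ⟨X₁, π₁, hprop, hbir, hint₁, hCM⟩

/-- A closed subscheme does not raise the (topological Krull) dimension: for the reduced closed subscheme
`V(I)` of an ideal sheaf, `dim V(I) ≤ dim X` (the closed immersion is a closed embedding, hence inducing).
[folklore] -/
theorem topologicalKrullDim_subscheme_le {X : Scheme.{0}} (I : X.IdealSheafData) :
    topologicalKrullDim I.subscheme ≤ topologicalKrullDim X :=
  (I.subschemeι.isClosedEmbedding).isInducing.topologicalKrullDim_le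

/-- **IN DIMENSION ≤ 2 THE CRUX IS THE F-INJECTIVIZATION OF NORMAL SURFACES.** Fix a prime `p` and a field `k` of
characteristic `p`. If every NORMAL integral separated finite-type `X₁/k` of dimension `≤ 2` (all local rings
integrally closed — hence Cohen–Macaulay, `normalModel_dim_le_two`) admits a proper birational model whose stalks
are Cohen–Macaulay domains with Frobenius closed parameter ideals (the open core `stub_fInjectivizeIntegral` of line
`Sketch` restricted to normal surfaces), then every REDUCED separated finite-type `X/k` of dimension `≤ 2` admits
such a model, i.e. the crux's conclusion holds for `X`: reduce to the integral components with their reduced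
structure (`exists_model_of_forall_closeds`; they have dimension `≤ 2`, `topologicalKrullDim_subscheme_le`),
normalize (`normalModel_dim_le_two`: proper birational, integral, normal, Cohen–Macaulay, dimension `≤ 2`),
F-injectivize by hypothesis, and compose (proper ∘ proper, `ComponentGluing.IsBirational.comp`). No named fact is
used. [folklore] -/
theorem conclusion_dim_le_two_of_fInjectivizeNormalSurfaces {p : ℕ} (k : Type) [Field k]
    (hF : ∀ (X₁ : Scheme.{0}) (f₁ : X₁ ⟶ Spec (.of k)), IsSeparated f₁ → LocallyOfFiniteType f₁ →
      QuasiCompact f₁ → IsIntegral X₁ → topologicalKrullDim X₁ ≤ 2 →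
      (∀ x : X₁, IsIntegrallyClosed (X₁.presheaf.stalk x)) →
      (∀ x : X₁, ∀ d : ℕ, ringKrullDim (X₁.presheaf.stalk x) = d →
        ∀ s : Fin d → X₁.presheaf.stalk x, (Ideal.span (Set.range s)).radical.IsMaximal →
          RingTheory.Sequence.IsWeaklyRegular (X₁.presheaf.stalk x) (List.ofFn s)) →
      ∃ (X' : Scheme.{0}) (π : X' ⟶ X₁), IsProper π ∧ IsBirational π ∧
        ∀ x : X', IsDomain (X'.presheaf.stalk x) ∧ ∀ d : ℕ, ringKrullDim (X'.presheaf.stalk x) = d →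
          ∀ s : Fin d → X'.presheaf.stalk x, (Ideal.span (Set.range s)).radical.IsMaximal →
            RingTheory.Sequence.IsWeaklyRegular (X'.presheaf.stalk x) (List.ofFn s) ∧
            ∀ y : X'.presheaf.stalk x, (∃ e : ℕ, y ^ p ^ e ∈
                Ideal.span ((fun z : X'.presheaf.stalk x => z ^ p ^ e) ''
                  (Ideal.span (Set.range s) : Set (X'.presheaf.stalk x)))) →
              y ∈ Ideal.span (Set.range s))
    (X : Scheme.{0}) (f : X ⟶ Spec (.of k)) [IsSeparated f] [LocallyOfFiniteType f] [QuasiCompact f]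
    [IsReduced X] (hdim : topologicalKrullDim X ≤ 2) :
    ∃ (X' : Scheme.{0}) (π : X' ⟶ X), IsProper π ∧ IsBirational π ∧ ∀ x : X',
      IsDomain (X'.presheaf.stalk x) ∧ ∀ d : ℕ, ringKrullDim (X'.presheaf.stalk x) = d →
        ∀ s : Fin d → X'.presheaf.stalk x, (Ideal.span (Set.range s)).radical.IsMaximal →
          RingTheory.Sequence.IsWeaklyRegular (X'.presheaf.stalk x) (List.ofFn s) ∧
          ∀ y : X'.presheaf.stalk x, (∃ e : ℕ, y ^ p ^ e ∈ Ideal.span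
            ((fun z : X'.presheaf.stalk x => z ^ p ^ e) ''
              (Ideal.span (Set.range s) : Set (X'.presheaf.stalk x)))) →
            y ∈ Ideal.span (Set.range s) := by
  refine exists_model_of_forall_closeds
    (fun Y : Scheme.{0} => ∀ y : Y, IsDomain (Y.presheaf.stalk y) ∧
      ∀ d : ℕ, ringKrullDim (Y.presheaf.stalk y) = d →
        ∀ s : Fin d → Y.presheaf.stalk y, (Ideal.span (Set.range s)).radical.IsMaximal →
          RingTheory.Sequence.IsWeaklyRegular (Y.presheaf.stalk y) (List.ofFn s) ∧
          ∀ w : Y.presheaf.stalk y, (∃ e : ℕ, w ^ p ^ e ∈ Ideal.span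
            ((fun z : Y.presheaf.stalk y => z ^ p ^ e) ''
              (Ideal.span (Set.range s) : Set (Y.presheaf.stalk y)))) →
            w ∈ Ideal.span (Set.range s))
    (fun Y hY y => (hY.false y).elim) (fun U V hU hV => fiClause_coprod p hU hV) X f fun Z hZ => ?_
  haveI := hZ
  -- the component `Z` with its reduced structure: integral, separated of finite type over `k`, dimension ≤ 2
  set Z₀ : Scheme.{0} := (Scheme.IdealSheafData.vanishingIdeal Z).subscheme with hZ₀
  let g : Z₀ ⟶ Spec (.of k) := (Scheme.IdealSheafData.vanishingIdeal Z).subschemeι ≫ f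
  have hdimZ : topologicalKrullDim Z₀ ≤ 2 :=
    (topologicalKrullDim_subscheme_le (Scheme.IdealSheafData.vanishingIdeal Z)).trans hdim
  haveI : IsSeparated g := inferInstance
  haveI : LocallyOfFiniteType g := inferInstance
  haveI : QuasiCompact g := inferInstance
  -- normalize: a normal Cohen–Macaulay integral model of dimension ≤ 2
  obtain ⟨X₁, π₁, hπ₁, hbir₁, hint₁, hdim₁, hnorm, hCM⟩ := normalModel_dim_le_two k Z₀ g hdimZ
  haveI := hπ₁
  have hsep₁ : IsSeparated (π₁ ≫ g) := inferInstance
  have hft₁ : LocallyOfFiniteType (π₁ ≫ g) := inferInstance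
  have hqc₁ : QuasiCompact (π₁ ≫ g) := inferInstance
  -- F-injectivize the normal surface and compose
  obtain ⟨X', π, hπ, hbir, hgood⟩ := hF X₁ (π₁ ≫ g) hsep₁ hft₁ hqc₁ hint₁ hdim₁ hnorm hCM
  haveI := hπ
  exact ⟨X', π ≫ π₁, inferInstance, ComponentGluing.IsBirational.comp hbir hbir₁, hgood⟩

/-- **The crux's conclusion in dimension ≤ 2 modulo resolution of surfaces**: for a reduced separated `X` of
finite type over a field `k` of characteristic `p` with `dim X ≤ 2`, the named fact `CossartJannsenSaito2020`
(weak resolution up to dimension 2 over every field; Lipman 1978 / Cossart–Jannsen–Saito 2020) yields the crux's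
model through `Negative.conclusion_of_hasResolution` (a resolution is an F-injective Macaulayfication). Recorded
next to `conclusion_dim_le_two_of_fInjectivizeNormalSurfaces` to mark what line `Sketch` has to beat in dimension 2:
F-injectivize normal surfaces WITHOUT resolving them. [cite: CossartJannsenSaito2020, Thm. 1.2] -/
theorem conclusion_of_dim_le_two (hCJS : CossartJannsenSaito2020.{0}) {p : ℕ} (hp : p.Prime)
    (k : Type) [Field k] [CharP k p] (X : Scheme.{0}) (f : X ⟶ Spec (.of k)) [IsSeparated f]
    [LocallyOfFiniteType f] [QuasiCompact f] [IsReduced X] (hdim : topologicalKrullDim X ≤ 2) :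
    ∃ (X' : Scheme.{0}) (π : X' ⟶ X), IsProper π ∧ IsBirational π ∧ ∀ x : X',
      IsDomain (X'.presheaf.stalk x) ∧ ∀ d : ℕ, ringKrullDim (X'.presheaf.stalk x) = d →
        ∀ s : Fin d → X'.presheaf.stalk x, (Ideal.span (Set.range s)).radical.IsMaximal →
          RingTheory.Sequence.IsWeaklyRegular (X'.presheaf.stalk x) (List.ofFn s) ∧
          ∀ y : X'.presheaf.stalk x, (∃ e : ℕ, y ^ p ^ e ∈ Ideal.span
            ((fun z : X'.presheaf.stalk x => z ^ p ^ e) ''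
              (Ideal.span (Set.range s) : Set (X'.presheaf.stalk x)))) →
            y ∈ Ideal.span (Set.range s) :=
  Negative.conclusion_of_hasResolution hp f
    (hCJS k X f inferInstance inferInstance inferInstance inferInstance (by exact_mod_cast hdim))

end Summit.ResolutionOfSingularities.ResolutionOfSingularities.Theorems.FInjectiveMacaulayfication.KawasakiDimLeTwo

end
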